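import Summits.CriticalPhenomena.CardyFormulaZ2.Theses.CardyLeeYang
import Literature.Probability.Percolation.LatticeTraceGeometry
import HarnessLib

/-!
# `stub_discretisedRectangleIsLatticeQuad` (line `birth` of crux `CrossingNumberRealRoots`,
# stmt-CriticalPhenomena-16787) is FALSE: at a coarse mesh the two opposite discrete arcs coincide

Negative lemma (refuter, skeleton vetting of `Cruxes/CrossingNumberRealRoots/Lines/birth.lean`,
sha `32bdf65f…`).  The third registered stub of that skeleton asserts that for EVERY conformal
rectangle `R` and EVERY mesh `δ > 0` the G02 data
`(discreteDomainGraph R.carrier δ, discreteArc R.carrier δ (R.arc 0), discreteArc R.carrier δ (R.arc 2))`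
is a *lattice quad*; the field `IsLatticeQuad.disjoint` of that class demands
`Disjoint (discreteArc … (R.arc 0)) (discreteArc … (R.arc 2))`.

**Witness against it:** `R = ConformalRectangle.unitDisc` (the unit disc marked at `1, i, -1, -i`)
and `δ = 1`.  The only site of `ℤ²` whose mesh point lies in the open unit disc is the origin, so the
discrete domain `Ω_δ` is `{0}` with no edges, `0` is a discrete-boundary vertex (its lattice
neighbour `e₀` is not joined to it), and `meshPoint 1 0 = 0` is at distance exactly `1` from every
point of `∂𝔻 = sphere 0 1`.  By the tie convention `≤` of `discreteArc` ("a boundary vertex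
equidistant from `A` and `∂Ω ∖ A` belongs to both"), `0` lies in the discrete arc of EVERY boundary
arc of the disc — in particular in those of the opposite arcs `R.arc 0` and `R.arc 2`, which are
therefore not disjoint (`discreteArc_arc_zero_two_not_disjoint`).  Hence no class of triples
containing a disjointness axiom can contain the G02 data of every `(R, δ)`:
`stub_discretisedRectangleIsLatticeQuad_false` refutes the registered statement for EVERY class
predicate entailing disjointness (so it specialises to the negation of the registered `def`, whose
`Cruxes/` module is not importable here), and `not_forall_disjoint_discreteArc` refutes
disjointness alone.

Classification (for the lead): the stub is *misstated at coarse mesh* — the crux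
`CrossingNumberRealRoots` quantifies over all `δ > 0`, so the line must cover degenerate meshes, but
at such meshes the G02 arcs tie.  (The crux itself survives this witness: there `N ≡ 1`, PGF `X`.)
Cheapest repairs: drop `disjoint` from `IsLatticeQuad` (and let `stub_latticeQuadRealRoots` allow
`A ∩ B ≠ ∅`), or split the composition into the separated regime (`δ` small relative to `R`, where
the arcs are resolved) and a direct argument for the degenerate meshes.
-/

noncomputable section

open Metric Set Real
open Literature.Probability.LatticeModels Literature.Probability.RandomPlanarGeometry
open Literature.Probability.Percolation

namespace Summit.CriticalPhenomena.CardyFormulaZ2.Theorems.CrossingNumberRealRoots.Negative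

/-! ## The unit disc at mesh `1` -/

/-- The carrier of the unit-disc conformal rectangle is the open unit ball. [folklore] -/
theorem carrier_unitDisc : ConformalRectangle.unitDisc.carrier = ball (0 : ℂ) 1 := rfl

/-- `meshPoint 1 0 = 0`. [folklore] -/
theorem meshPoint_one_zero : meshPoint 1 (0 : Site 2) = 0 := by
  apply Complex.ext <;> simp [meshPoint_re, meshPoint_im]

/-- At mesh `1`, the only mesh vertex of the open unit disc is the origin. [folklore] -/
theorem eq_zero_of_mem_meshVertices {x : Site 2} (hx : x ∈ meshVertices (ball (0 : ℂ) 1) 1) :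
    x = 0 := by
  rw [mem_meshVertices_iff, mem_ball_zero_iff] at hx
  have hre : |((x 0 : ℤ) : ℝ)| < 1 := by
    have h := (Complex.abs_re_le_norm (meshPoint 1 x)).trans_lt hx
    simpa [meshPoint_re] using h
  have him : |((x 1 : ℤ) : ℝ)| < 1 := by
    have h := (Complex.abs_im_le_norm (meshPoint 1 x)).trans_lt hx
    simpa [meshPoint_im] using h
  have h0 : x 0 = 0 := by
    rw [← Int.cast_abs] at hre
    exact Int.abs_lt_one_iff.1 (by exact_mod_cast hre)
  have h1 : x 1 = 0 := by
    rw [← Int.cast_abs] at him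
    exact Int.abs_lt_one_iff.1 (by exact_mod_cast him)
  ext i
  fin_cases i
  · exact h0
  · exact h1

/-- The origin is a mesh vertex of the unit disc at mesh `1`. [folklore] -/
theorem zero_mem_meshVertices : (0 : Site 2) ∈ meshVertices (ball (0 : ℂ) 1) 1 := by
  rw [mem_meshVertices_iff, meshPoint_one_zero]
  exact mem_ball_self one_pos

/-- The origin belongs to the discrete domain `Ω_δ` of the unit disc at mesh `1` (the mesh-vertex
graph has a single vertex, hence a single — automatically largest — component). [folklore] -/
theorem zero_mem_meshDomain : (0 : Site 2) ∈ meshDomain (ball (0 : ℂ) 1) 1 := by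
  have hsub : Subsingleton (meshVertices (ball (0 : ℂ) 1) 1) :=
    ⟨fun a b => Subtype.ext
      ((eq_zero_of_mem_meshVertices a.2).trans (eq_zero_of_mem_meshVertices b.2).symm)⟩
  let v : meshVertices (ball (0 : ℂ) 1) 1 := ⟨0, zero_mem_meshVertices⟩
  simp only [meshDomain, mem_iUnion, mem_image]
  refine ⟨(meshVertexGraph (ball (0 : ℂ) 1) 1).connectedComponentMk v, ?_, v, ?_, rfl⟩
  · intro C'
    induction C' using SimpleGraph.ConnectedComponent.ind with
    | h w => rw [Subsingleton.elim w v]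
  · exact (SimpleGraph.ConnectedComponent.mem_supp_iff _ _).2 rfl

/-- The origin is a discrete-boundary vertex of the unit disc at mesh `1`: its lattice neighbour
`e₀` is not a vertex of `Ω_δ`. [folklore] -/
theorem zero_mem_meshBoundary : (0 : Site 2) ∈ meshBoundary (ball (0 : ℂ) 1) 1 := by
  refine ⟨zero_mem_meshDomain, Pi.single 0 1, (zdGraph_adj_iff _ _).2 ⟨0, Or.inl (zero_add _).symm⟩,
    fun h => ?_⟩
  have hy := eq_zero_of_mem_meshVertices
    (meshDomain_subset_meshVertices _ _ (discreteDomainGraph_adj_iff.1 h).2.2)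
  have h1 : (Pi.single (0 : Fin 2) (1 : ℤ) : Site 2) 0 = (0 : Site 2) 0 := by rw [hy]
  simp at h1

/-! ## Every discrete arc of the disc contains the origin -/

/-- The real part of the boundary point of the disc at parameter `t` is `cos (2πt)`. [folklore] -/
theorem unitDisc_boundary_re (t : ℝ) :
    (ConformalRectangle.unitDisc.boundary t).re = Real.cos (2 * π * t) := by
  show (circleMap 0 1 (2 * π * t)).re = Real.cos (2 * π * t)
  simp only [circleMap, zero_add, Complex.ofReal_one, one_mul, Complex.exp_ofReal_mul_I_re]

/-- `-1` is not on the first arc (parameters `[0, 1/4]`, the closed first-quadrant arc). [folklore] -/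
theorem neg_one_notMem_arc_zero : (-1 : ℂ) ∉ ConformalRectangle.unitDisc.arc 0 := by
  rintro ⟨t, ht, h⟩
  have hn : ConformalRectangle.unitDisc.nextMark 0 = 1 / 4 := by
    simp [MarkedDomain.nextMark, ConformalRectangle.unitDisc]
  have hm : ConformalRectangle.unitDisc.mark 0 = 0 := by
    simp [ConformalRectangle.unitDisc]
  rw [hn, hm] at ht
  have hre := congrArg Complex.re h
  rw [unitDisc_boundary_re] at hre
  have hcos : 0 ≤ Real.cos (2 * π * t) :=
    Real.cos_nonneg_of_mem_Icc ⟨by nlinarith [pi_pos, ht.1], by nlinarith [pi_pos, ht.2]⟩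
  norm_num at hre
  linarith

/-- `1` is not on the third arc (parameters `[1/2, 3/4]`, the closed third-quadrant arc). [folklore] -/
theorem one_notMem_arc_two : (1 : ℂ) ∉ ConformalRectangle.unitDisc.arc 2 := by
  rintro ⟨t, ht, h⟩
  have hn : ConformalRectangle.unitDisc.nextMark 2 = 3 / 4 := by
    simp [MarkedDomain.nextMark, ConformalRectangle.unitDisc]
  have hm : ConformalRectangle.unitDisc.mark 2 = 1 / 2 := by
    simp [ConformalRectangle.unitDisc]
  rw [hn, hm] at ht
  have hre := congrArg Complex.re h
  rw [unitDisc_boundary_re] at hre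
  have hcos : Real.cos (2 * π * t) ≤ 0 :=
    Real.cos_nonpos_of_pi_div_two_le_of_le (by nlinarith [pi_pos, ht.1])
      (by nlinarith [pi_pos, ht.2])
  norm_num at hre
  linarith

/-- If some point of the unit circle is missed by the boundary arc `A`, then the origin lies in
the discrete arc of `A` at mesh `1`: it is a boundary vertex at distance `≤ 1` from `A ⊆ ∂𝔻`
(nonempty) and at distance `≥ 1` from `∂𝔻 ∖ A ⊆ ∂𝔻`. [folklore] -/
theorem zero_mem_discreteArc {A : Set ℂ} (hA : A ⊆ sphere (0 : ℂ) 1) (hne : A.Nonempty)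
    {z : ℂ} (hz : z ∈ sphere (0 : ℂ) 1) (hzA : z ∉ A) :
    (0 : Site 2) ∈ discreteArc (ball (0 : ℂ) 1) 1 A := by
  refine ⟨zero_mem_meshBoundary, ?_⟩
  rw [meshPoint_one_zero, frontier_ball (0 : ℂ) one_ne_zero]
  obtain ⟨a, ha⟩ := hne
  calc infDist (0 : ℂ) A ≤ dist (0 : ℂ) a := infDist_le_dist_of_mem ha
    _ = 1 := by rw [dist_comm]; exact mem_sphere.1 (hA ha)
    _ ≤ infDist (0 : ℂ) (sphere (0 : ℂ) 1 \ A) := by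
        refine (le_infDist (⟨z, hz, hzA⟩ : (sphere (0 : ℂ) 1 \ A).Nonempty)).2 fun y hy => ?_
        rw [dist_comm, mem_sphere.1 hy.1]

/-- The origin lies in the discrete arc of `R.arc 0` (unit disc, mesh `1`). [folklore] -/
theorem zero_mem_discreteArc_arc_zero :
    (0 : Site 2) ∈ discreteArc ConformalRectangle.unitDisc.carrier 1
      (ConformalRectangle.unitDisc.arc 0) := by
  have hfr : frontier ConformalRectangle.unitDisc.carrier = sphere (0 : ℂ) 1 :=
    frontier_ball (0 : ℂ) one_ne_zero
  have hsub : ConformalRectangle.unitDisc.arc 0 ⊆ sphere (0 : ℂ) 1 :=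
    hfr ▸ MarkedDomain.arc_subset_frontier ConformalRectangle.unitDisc 0
  have hz : (-1 : ℂ) ∈ sphere (0 : ℂ) 1 := by simp
  show (0 : Site 2) ∈ discreteArc (ball (0 : ℂ) 1) 1 (ConformalRectangle.unitDisc.arc 0)
  exact zero_mem_discreteArc hsub ⟨_, MarkedDomain.pt_mem_arc_self ConformalRectangle.unitDisc 0⟩
    hz neg_one_notMem_arc_zero

/-- The origin lies in the discrete arc of `R.arc 2` (unit disc, mesh `1`). [folklore] -/
theorem zero_mem_discreteArc_arc_two :
    (0 : Site 2) ∈ discreteArc ConformalRectangle.unitDisc.carrier 1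
      (ConformalRectangle.unitDisc.arc 2) := by
  have hfr : frontier ConformalRectangle.unitDisc.carrier = sphere (0 : ℂ) 1 :=
    frontier_ball (0 : ℂ) one_ne_zero
  have hsub : ConformalRectangle.unitDisc.arc 2 ⊆ sphere (0 : ℂ) 1 :=
    hfr ▸ MarkedDomain.arc_subset_frontier ConformalRectangle.unitDisc 2
  have hz : (1 : ℂ) ∈ sphere (0 : ℂ) 1 := by simp
  show (0 : Site 2) ∈ discreteArc (ball (0 : ℂ) 1) 1 (ConformalRectangle.unitDisc.arc 2)
  exact zero_mem_discreteArc hsub ⟨_, MarkedDomain.pt_mem_arc_self ConformalRectangle.unitDisc 2⟩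
    hz one_notMem_arc_two

/-- **The two opposite discrete arcs of the unit disc at mesh `1` are not disjoint** (both contain
the origin). [folklore] -/
theorem discreteArc_arc_zero_two_not_disjoint :
    ¬ Disjoint (discreteArc ConformalRectangle.unitDisc.carrier 1 (ConformalRectangle.unitDisc.arc 0))
      (discreteArc ConformalRectangle.unitDisc.carrier 1 (ConformalRectangle.unitDisc.arc 2)) :=
  fun h => Set.disjoint_left.1 h zero_mem_discreteArc_arc_zero zero_mem_discreteArc_arc_two

/-- **Disjointness of the opposite G02 discrete arcs fails for some `(R, δ)`, `δ > 0`.** Any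
"lattice quad" class with a disjointness axiom therefore misses the G02 data of some conformal
rectangle at some positive mesh. [folklore] -/
theorem not_forall_disjoint_discreteArc :
    ¬ ∀ (R : ConformalRectangle) (δ : ℝ), 0 < δ →
      Disjoint (discreteArc R.carrier δ (R.arc 0)) (discreteArc R.carrier δ (R.arc 2)) :=
  fun h => discreteArc_arc_zero_two_not_disjoint (h _ 1 one_pos)

/-! ## The registered stub is false

The registered statement is
`stub_discretisedRectangleIsLatticeQuad : Prop := ∀ R δ, 0 < δ → IsLatticeQuad (discreteDomainGraph
R.carrier δ) (discreteArc R.carrier δ (R.arc 0)) (discreteArc R.carrier δ (R.arc 2))`, where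
`IsLatticeQuad H A B` is a `structure … : Prop` of `Lines/birth.lean` with the field
`disjoint : Disjoint A B` (the `Cruxes/` work module is not an importable library module, and
re-declaring the structure here would add a vendored definition).  The refutation is therefore
stated for EVERY predicate `IsLQ` with a disjointness consequence; instantiating
`IsLQ := Birth.IsLatticeQuad`, `hdisj := fun _ _ _ h => h.disjoint` gives literally
`¬ Birth.stub_discretisedRectangleIsLatticeQuad` (the handle `def` unfolds to this `∀`). -/

/-- **`stub_discretisedRectangleIsLatticeQuad` is false**, uniformly in the class: no predicate on
triples `(H, A, B)` that entails `Disjoint A B` holds for the G02 data of every conformal rectangle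
at every positive mesh (witness `R = unitDisc`, `δ = 1`, where both discrete arcs contain `0`).
With `IsLQ := IsLatticeQuad` of `Lines/birth.lean` this is `¬ stub_discretisedRectangleIsLatticeQuad`. [folklore] -/
theorem stub_discretisedRectangleIsLatticeQuad_false
    {IsLQ : SimpleGraph (Site 2) → Set (Site 2) → Set (Site 2) → Prop}
    (hdisj : ∀ H A B, IsLQ H A B → Disjoint A B) :
    ¬ ∀ (R : ConformalRectangle) (δ : ℝ), 0 < δ →
      IsLQ (discreteDomainGraph R.carrier δ) (discreteArc R.carrier δ (R.arc 0))
        (discreteArc R.carrier δ (R.arc 2)) :=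
  fun h => discreteArc_arc_zero_two_not_disjoint (hdisj _ _ _ (h ConformalRectangle.unitDisc 1 one_pos))

end Summit.CriticalPhenomena.CardyFormulaZ2.Theorems.CrossingNumberRealRoots.Negative

end
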